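import Summits.QuantumFields.YangMills.Theorems.StaticSourceWitnessRungDefs

/-!
# Route `StaticSourceWitness`, crux X₁ `StaticSourceResponse` (stmt-QuantumFields-25284):
# lattice-Maxwell rung, file 1/5 — Gaussian trigonometric moments and the static-source identity (★)
# in canonical coordinates

Banking file (`--supports stmt-QuantumFields-25284`), port of Part A.1–A.2 of the crux workfile
`Cruxes/StaticSourceResponse/Lines/rung.lean` v3 (seat `ym-mirror-bc5w-1`, 2026-08-28).

**The lever of X₁** is the normalisation `c₁·E[w] ≤ |Cov(w∘θ, Ṽ_v)|`: a far-mirror Wilson loop `w`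
whose expectation is perimeter-law SMALL still certifies an `O(1)` response RATIO.  In a free
(Gaussian, abelian) gauge theory this is an exact identity.  With the mirror loop `w = cos Φ`
(`Φ` the abelian holonomy angle) and a plaquette energy `Y²`, for a centred jointly Gaussian pair
`(Φ, Y)`:

  `Cov(cos Φ, Y²) = −E[cos Φ]·Cov(Φ, Y)²`,  `E[cos Φ] = e^{−Var Φ/2} > 0`.      (★)

This file: Part A.1 — the standard-normal trigonometric moments `E[cos sξ] = e^{−s²/2}`,
`E[ξ cos sξ] = 0`, `E[ξ² cos sξ] = (1 − s²)e^{−s²/2}` from Mathlib's `charFun_gaussianReal` and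
`iteratedDeriv_charFun`; Part A.2 — (★) for the canonical pair `(Φ, Y) = (sξ₁, pξ₁ + qξ₂)`,
`ξ₁, ξ₂` i.i.d. `N(0,1)` (`gaussian_staticSource_identity`), and X₁'s witness clause in this model
(`gaussian_staticSource_floor`): a floor `Cov(Φ,Y)² ≥ c₁` gives `0 < E[w] ∧ c₁·E[w] ≤ |Cov(w, Y²)|`
with the SAME `c₁` whatever `Var Φ = s²` is.  File 2/5 (`…GaussianPair`) transports (★) to any
centred Gaussian pair; files 3–5 instantiate it in the lattice Maxwell field.

NOTHING here proves the Yang–Mills mass gap, `BalabanLadder.NT`, or X₁.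
-/

set_option autoImplicit false

open MeasureTheory ProbabilityTheory Complex
open scoped Real NNReal ENNReal

noncomputable section

namespace Summit.QuantumFields.YangMills.Theorems.StaticSourceWitness.Rung

/-! ## Part A.1 — standard Gaussian trigonometric moments via the characteristic function -/

/-- The characteristic function of `γ` is `F`: `charFun γ t = e^{−t²/2}`. [folklore] -/
theorem charFun_γ (t : ℝ) : charFun γ t = F t := by
  rw [charFun_gaussianReal, F]
  congr 1
  push_cast
  ring

/-- `charFun γ = F` as functions. [folklore] -/
theorem charFun_eq_F : charFun γ = F := funext charFun_γ

/-- Derivative of `x ↦ −x²/2`. [folklore] -/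
theorem hasDerivAt_negSqHalf (t : ℝ) : HasDerivAt (fun x : ℝ => -(x ^ 2 / 2)) (-t) t := by
  have h : HasDerivAt (fun x : ℝ => x ^ 2 / 2) t t := by
    refine ((hasDerivAt_pow 2 t).div_const 2).congr_deriv ?_
    rw [show (2 : ℕ) - 1 = 1 from rfl, pow_one]
    push_cast
    ring
  exact h.neg

/-- `F' (t) = −t F(t)`. [folklore] -/
theorem hasDerivAt_F (t : ℝ) : HasDerivAt F (F t * ((-t : ℝ) : ℂ)) t :=
  (hasDerivAt_negSqHalf t).ofReal_comp.cexp

/-- `deriv F = (t ↦ −t F t)`. [folklore] -/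
theorem deriv_F : deriv F = fun t => F t * ((-t : ℝ) : ℂ) :=
  funext fun t => (hasDerivAt_F t).deriv

/-- `F'' (t) = (t² − 1) F(t)`. [folklore] -/
theorem iteratedDeriv_two_F (t : ℝ) : iteratedDeriv 2 F t = F t * ((t ^ 2 - 1 : ℝ) : ℂ) := by
  rw [iteratedDeriv_succ, iteratedDeriv_one, deriv_F]
  have h2 : HasDerivAt (fun t : ℝ => F t * ((-t : ℝ) : ℂ))
      (F t * ((-t : ℝ) : ℂ) * ((-t : ℝ) : ℂ) + F t * ((-1 : ℝ) : ℂ)) t :=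
    (hasDerivAt_F t).mul (hasDerivAt_neg (x := t)).ofReal_comp
  rw [h2.deriv]
  push_cast
  ring

/-- `γ` has a second moment. [folklore] -/
theorem memLp_two_γ : MemLp id 2 γ := memLp_id_gaussianReal' 2 (by simp)

/-- `x ↦ x²` is `γ`-integrable. [folklore] -/
theorem integrable_sq_γ : Integrable (fun x : ℝ => x ^ 2) γ := by
  have h := (memLp_two_iff_integrable_sq measurable_id.aestronglyMeasurable).1 memLp_two_γ
  simpa using h

/-- `x ↦ x` is `γ`-integrable. [folklore] -/
theorem integrable_id_γ : Integrable (fun x : ℝ => x) γ :=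
  memLp_one_iff_integrable.1 (memLp_id_gaussianReal' 1 (by simp))

/-- `x ↦ |x|` is `γ`-integrable. [folklore] -/
theorem integrable_abs_γ : Integrable (fun x : ℝ => |x|) γ := by
  simpa [Real.norm_eq_abs] using integrable_id_γ.norm

/-- `∫ e^{isx} dγ = e^{−s²/2}`. [folklore] -/
theorem integral_cexp (s : ℝ) : ∫ x, Complex.exp ((s : ℂ) * x * I) ∂γ = F s := by
  rw [← charFun_apply_real, charFun_γ]

/-- `∫ x e^{isx} dγ = i s e^{−s²/2}`. [folklore] -/
theorem integral_x_cexp (s : ℝ) :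
    ∫ x, (x : ℂ) * Complex.exp ((s : ℂ) * x * I) ∂γ = I * (s : ℂ) * F s := by
  have hint : MemLp id ((1 : ℕ) : ℝ≥0∞) γ := by
    rw [Nat.cast_one]; exact memLp_id_gaussianReal' 1 (by simp)
  have h := iteratedDeriv_charFun (μ := γ) (n := 1) (t := s) hint
  rw [iteratedDeriv_one, charFun_eq_F, deriv_F] at h
  simp only [pow_one] at h
  have h' : ∫ x, (x : ℂ) * Complex.exp ((s : ℂ) * x * I) ∂γ = -I * (F s * ((-s : ℝ) : ℂ)) := by
    rw [h, ← mul_assoc, show -I * I = 1 by rw [neg_mul, I_mul_I, neg_neg], one_mul]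
  rw [h']
  push_cast
  ring

/-- `∫ x² e^{isx} dγ = (1 − s²) e^{−s²/2}`. [folklore] -/
theorem integral_x2_cexp (s : ℝ) :
    ∫ x, (x : ℂ) ^ 2 * Complex.exp ((s : ℂ) * x * I) ∂γ = F s * ((1 - s ^ 2 : ℝ) : ℂ) := by
  have h := iteratedDeriv_charFun (μ := γ) (n := 2) (t := s) memLp_two_γ
  rw [charFun_eq_F, iteratedDeriv_two_F] at h
  have h' : ∫ x, (x : ℂ) ^ 2 * Complex.exp ((s : ℂ) * x * I) ∂γ = -(F s * ((s ^ 2 - 1 : ℝ) : ℂ)) := by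
    rw [h, I_sq]; ring
  rw [h']
  push_cast
  ring

/-- Real part of `F s · a` for real `a`. [folklore] -/
theorem re_F_mul (s a : ℝ) : (F s * (a : ℂ)).re = Real.exp (-(s ^ 2 / 2)) * a := by
  rw [F, ← Complex.ofReal_exp, ← Complex.ofReal_mul, Complex.ofReal_re]

/-- `E[cos(sξ)] = e^{−s²/2}`. [folklore] -/
theorem integral_cos (s : ℝ) : ∫ x, Real.cos (s * x) ∂γ = Real.exp (-(s ^ 2 / 2)) := by
  have hf : Integrable (fun x : ℝ => Complex.exp ((s : ℂ) * x * I)) γ := by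
    refine (integrable_const (1 : ℝ)).mono' (by fun_prop) (Filter.Eventually.of_forall fun x => ?_)
    rw [← Complex.ofReal_mul, Complex.norm_exp_ofReal_mul_I]
  have h := congrArg Complex.re (integral_cexp s)
  have hre := integral_re hf
  simp only [RCLike.re_to_complex] at hre
  rw [← hre] at h
  have e : ∀ x : ℝ, (Complex.exp ((s : ℂ) * x * I)).re = Real.cos (s * x) := fun x => by
    rw [← Complex.ofReal_mul]; exact Complex.exp_ofReal_mul_I_re _
  simp_rw [e] at h
  rw [h]
  have := re_F_mul s 1
  simpa using this

/-- `E[ξ cos(sξ)] = 0`. [folklore] -/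
theorem integral_x_cos (s : ℝ) : ∫ x, x * Real.cos (s * x) ∂γ = 0 := by
  have hf : Integrable (fun x : ℝ => (x : ℂ) * Complex.exp ((s : ℂ) * x * I)) γ := by
    refine integrable_abs_γ.mono' (by fun_prop) (Filter.Eventually.of_forall fun x => ?_)
    rw [norm_mul, ← Complex.ofReal_mul, Complex.norm_exp_ofReal_mul_I, mul_one, Complex.norm_real,
      Real.norm_eq_abs]
  have h := congrArg Complex.re (integral_x_cexp s)
  have hre := integral_re hf
  simp only [RCLike.re_to_complex] at hre
  rw [← hre] at h
  have e : ∀ x : ℝ, ((x : ℂ) * Complex.exp ((s : ℂ) * x * I)).re = x * Real.cos (s * x) :=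
    fun x => by
      rw [← Complex.ofReal_mul]
      show ((x : ℂ) * Complex.exp (((s * x : ℝ) : ℂ) * I)).re = _
      rw [Complex.re_ofReal_mul, Complex.exp_ofReal_mul_I_re]
  simp_rw [e] at h
  rw [h, F, ← Complex.ofReal_exp, mul_assoc, ← Complex.ofReal_mul, Complex.I_mul_re,
    Complex.ofReal_im, neg_zero]

/-- `E[ξ² cos(sξ)] = (1 − s²) e^{−s²/2}`. [folklore] -/
theorem integral_x2_cos (s : ℝ) :
    ∫ x, x ^ 2 * Real.cos (s * x) ∂γ = Real.exp (-(s ^ 2 / 2)) * (1 - s ^ 2) := by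
  have hf : Integrable (fun x : ℝ => (x : ℂ) ^ 2 * Complex.exp ((s : ℂ) * x * I)) γ := by
    refine integrable_sq_γ.mono' (by fun_prop) (Filter.Eventually.of_forall fun x => ?_)
    rw [norm_mul, ← Complex.ofReal_mul, Complex.norm_exp_ofReal_mul_I, mul_one, norm_pow,
      Complex.norm_real, Real.norm_eq_abs, sq_abs]
  have h := congrArg Complex.re (integral_x2_cexp s)
  have hre := integral_re hf
  simp only [RCLike.re_to_complex] at hre
  rw [← hre] at h
  have e : ∀ x : ℝ, ((x : ℂ) ^ 2 * Complex.exp ((s : ℂ) * x * I)).re = x ^ 2 * Real.cos (s * x) :=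
    fun x => by
      rw [← Complex.ofReal_mul, ← Complex.ofReal_pow]
      show (((x ^ 2 : ℝ) : ℂ) * Complex.exp (((s * x : ℝ) : ℂ) * I)).re = _
      rw [Complex.re_ofReal_mul, Complex.exp_ofReal_mul_I_re]
  simp_rw [e] at h
  rw [h, re_F_mul]

/-- Second moment `E[ξ²] = 1` (the `s = 0` case). [folklore] -/
theorem integral_x2 : ∫ x, x ^ 2 ∂γ = 1 := by
  have := integral_x2_cos 0
  simpa using this

/-- First moment `E[ξ] = 0`. [folklore] -/
theorem integral_x1 : ∫ x, x ∂γ = 0 := integral_id_gaussianReal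

/-- `x ↦ cos(sx)` is `γ`-integrable. [folklore] -/
theorem integrable_cos (s : ℝ) : Integrable (fun x : ℝ => Real.cos (s * x)) γ :=
  (integrable_const (1 : ℝ)).mono' (by fun_prop)
    (Filter.Eventually.of_forall fun x => by
      simpa [Real.norm_eq_abs] using Real.abs_cos_le_one (s * x))

/-- `x ↦ x cos(sx)` is `γ`-integrable. [folklore] -/
theorem integrable_x_cos (s : ℝ) : Integrable (fun x : ℝ => x * Real.cos (s * x)) γ :=
  integrable_abs_γ.mono' (by fun_prop)
    (Filter.Eventually.of_forall fun x => by
      rw [norm_mul, Real.norm_eq_abs, Real.norm_eq_abs]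
      exact mul_le_of_le_one_right (abs_nonneg x) (Real.abs_cos_le_one _))

/-- `x ↦ x² cos(sx)` is `γ`-integrable. [folklore] -/
theorem integrable_x2_cos (s : ℝ) : Integrable (fun x : ℝ => x ^ 2 * Real.cos (s * x)) γ :=
  integrable_sq_γ.mono' (by fun_prop)
    (Filter.Eventually.of_forall fun x => by
      rw [norm_mul, Real.norm_eq_abs, Real.norm_eq_abs, abs_of_nonneg (sq_nonneg x)]
      exact mul_le_of_le_one_right (sq_nonneg x) (Real.abs_cos_le_one _))

/-! ## Part A.2 — the centred 2D Gaussian pair in Cholesky coordinates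
`Φ = s ξ₁` (static source: mirror-loop holonomy angle), `Y = p ξ₁ + q ξ₂` (one plaquette curvature);
`w = cos Φ` (abelian Wilson loop), `Y²` (plaquette energy). -/

/-- `E[cos Φ · Y²] = e^{−s²/2} (p²(1−s²) + q²)`. [folklore] -/
theorem integral_cos_mul_Y2 (s p q : ℝ) :
    ∫ ξ, Real.cos (s * ξ.1) * (p * ξ.1 + q * ξ.2) ^ 2 ∂μ2
      = Real.exp (-(s ^ 2 / 2)) * (p ^ 2 * (1 - s ^ 2) + q ^ 2) := by
  have e : ∀ ξ : ℝ × ℝ, Real.cos (s * ξ.1) * (p * ξ.1 + q * ξ.2) ^ 2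
      = p ^ 2 * ((ξ.1 ^ 2 * Real.cos (s * ξ.1)) * 1) + 2 * p * q * ((ξ.1 * Real.cos (s * ξ.1)) * ξ.2)
        + q ^ 2 * (Real.cos (s * ξ.1) * ξ.2 ^ 2) := fun ξ => by ring
  simp_rw [e]
  have h1 : Integrable (fun ξ : ℝ × ℝ => p ^ 2 * ((ξ.1 ^ 2 * Real.cos (s * ξ.1)) * 1)) μ2 :=
    (((integrable_x2_cos s).mul_prod (integrable_const (1 : ℝ))).const_mul _)
  have h2 : Integrable (fun ξ : ℝ × ℝ => 2 * p * q * ((ξ.1 * Real.cos (s * ξ.1)) * ξ.2)) μ2 :=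
    (((integrable_x_cos s).mul_prod integrable_id_γ).const_mul _)
  have h3 : Integrable (fun ξ : ℝ × ℝ => q ^ 2 * (Real.cos (s * ξ.1) * ξ.2 ^ 2)) μ2 :=
    (((integrable_cos s).mul_prod integrable_sq_γ).const_mul _)
  have h12 : Integrable (fun ξ : ℝ × ℝ => p ^ 2 * ((ξ.1 ^ 2 * Real.cos (s * ξ.1)) * 1)
      + 2 * p * q * ((ξ.1 * Real.cos (s * ξ.1)) * ξ.2)) μ2 := h1.add h2
  rw [integral_add h12 h3, integral_add h1 h2, integral_const_mul, integral_const_mul,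
    integral_const_mul,
    integral_prod_mul (μ := γ) (ν := γ) (fun x : ℝ => x ^ 2 * Real.cos (s * x)) (fun _ : ℝ => (1 : ℝ)),
    integral_prod_mul (μ := γ) (ν := γ) (fun x : ℝ => x * Real.cos (s * x)) (fun y : ℝ => y),
    integral_prod_mul (μ := γ) (ν := γ) (fun x : ℝ => Real.cos (s * x)) (fun y : ℝ => y ^ 2),
    integral_x2_cos, integral_x_cos, integral_cos, integral_x2, integral_x1]
  have hc : ∫ _x : ℝ, (1 : ℝ) ∂γ = 1 := by simp
  rw [hc]
  ring

/-- `E[cos Φ] = e^{−s²/2}` — the perimeter-law-small witness size. [folklore] -/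
theorem integral_cosΦ (s : ℝ) : ∫ ξ, Real.cos (s * ξ.1) ∂μ2 = Real.exp (-(s ^ 2 / 2)) := by
  have h := integral_prod_mul (μ := γ) (ν := γ) (fun x : ℝ => Real.cos (s * x)) (fun _ : ℝ => (1 : ℝ))
  simp only [mul_one] at h
  rw [h, integral_cos]
  simp

/-- `E[Y²] = p² + q²`. [folklore] -/
theorem integral_Y2 (p q : ℝ) : ∫ ξ, (p * ξ.1 + q * ξ.2) ^ 2 ∂μ2 = p ^ 2 + q ^ 2 := by
  have := integral_cos_mul_Y2 0 p q
  simpa using this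

/-- `Cov(Φ, Y) = E[Φ Y] = s p`. [folklore] -/
theorem integral_ΦY (s p q : ℝ) : ∫ ξ, (s * ξ.1) * (p * ξ.1 + q * ξ.2) ∂μ2 = s * p := by
  have e : ∀ ξ : ℝ × ℝ, (s * ξ.1) * (p * ξ.1 + q * ξ.2)
      = s * p * (ξ.1 ^ 2 * 1) + s * q * (ξ.1 * ξ.2) := fun ξ => by ring
  simp_rw [e]
  have h1 : Integrable (fun ξ : ℝ × ℝ => s * p * (ξ.1 ^ 2 * 1)) μ2 :=
    ((integrable_sq_γ.mul_prod (integrable_const (1 : ℝ))).const_mul _)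
  have h2 : Integrable (fun ξ : ℝ × ℝ => s * q * (ξ.1 * ξ.2)) μ2 :=
    ((integrable_id_γ.mul_prod integrable_id_γ).const_mul _)
  rw [integral_add h1 h2, integral_const_mul, integral_const_mul,
    integral_prod_mul (μ := γ) (ν := γ) (fun x : ℝ => x ^ 2) (fun _ : ℝ => (1 : ℝ)),
    integral_prod_mul (μ := γ) (ν := γ) (fun x : ℝ => x) (fun y : ℝ => y),
    integral_x2, integral_x1]
  simp

/-- **The Gaussian static-source response identity** (★):
`Cov(cos Φ, Y²) = −E[cos Φ] · Cov(Φ, Y)²` for the centred Gaussian pair `(Φ, Y) = (sξ₁, pξ₁+qξ₂)`.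
The response of a plaquette energy to an abelian static source is, relative to the source's own
expectation, exactly minus the square of the classical (linear-response) field. [folklore] -/
theorem gaussian_staticSource_identity (s p q : ℝ) :
    (∫ ξ, Real.cos (s * ξ.1) * (p * ξ.1 + q * ξ.2) ^ 2 ∂μ2)
      - (∫ ξ, Real.cos (s * ξ.1) ∂μ2) * (∫ ξ, (p * ξ.1 + q * ξ.2) ^ 2 ∂μ2)
      = -((∫ ξ, Real.cos (s * ξ.1) ∂μ2) * (∫ ξ, (s * ξ.1) * (p * ξ.1 + q * ξ.2) ∂μ2) ^ 2) := by
  rw [integral_cos_mul_Y2, integral_cosΦ, integral_Y2, integral_ΦY]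
  ring

/-- **X₁'s witness clause in the free model (canonical coordinates)**: a dipole-coupling floor
`Cov(Φ,Y)² ≥ c₁` yields `0 < E[w] ∧ c₁·E[w] ≤ |Cov(w, Y²)|` for the abelian Wilson loop `w = cos Φ`,
with the SAME `c₁` whatever `Var Φ = s²` is — the witness may be arbitrarily (perimeter-law) small,
the certified response ratio is not. -/
theorem gaussian_staticSource_floor {c₁ s p q : ℝ} (hc : c₁ ≤ (s * p) ^ 2) :
    0 < ∫ ξ, Real.cos (s * ξ.1) ∂μ2 ∧
    c₁ * ∫ ξ, Real.cos (s * ξ.1) ∂μ2 ≤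
      |(∫ ξ, Real.cos (s * ξ.1) * (p * ξ.1 + q * ξ.2) ^ 2 ∂μ2)
        - (∫ ξ, Real.cos (s * ξ.1) ∂μ2) * (∫ ξ, (p * ξ.1 + q * ξ.2) ^ 2 ∂μ2)| := by
  have hpos : 0 < ∫ ξ, Real.cos (s * ξ.1) ∂μ2 := by rw [integral_cosΦ]; exact Real.exp_pos _
  refine ⟨hpos, ?_⟩
  rw [gaussian_staticSource_identity, integral_ΦY, abs_neg,
    abs_of_nonneg (mul_nonneg hpos.le (sq_nonneg _)), mul_comm]
  exact mul_le_mul_of_nonneg_left hc hpos.le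

/-- The witness is exponentially small in the source's variance (perimeter law of the free loop:
`Var Φ ∝ |∂C|/a`), yet the floor above is uniform: the two facts X₁'s normalisation is designed
around, decided in the free model. -/
theorem gaussian_witness_small (s : ℝ) :
    ∫ ξ, Real.cos (s * ξ.1) ∂μ2 = Real.exp (-(s ^ 2 / 2)) := integral_cosΦ s

end Summit.QuantumFields.YangMills.Theorems.StaticSourceWitness.Rung

end
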